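import Summits.BirchSwinnertonDyer.BirchSwinnertonDyer.Theorems.ManinLocalTwoThreePShiftTransferPair
import Summits.BirchSwinnertonDyer.BirchSwinnertonDyer.Theorems.ManinLocalTwoThreeCubeStep
import HarnessLib

/-!
# The prime-generic transfer step, III: descent `Γ₀(pM) → Γ₀(M)` (`p ∤ M`) for every prime `p ≥ 5` — `K_p(pM) = D(pM)`
# (route `ManinLocalTwoThree`, cell bsd-f2-manin; cruxes C2 stmt-BirchSwinnertonDyer-22967 / C3 stmt-…-22968; LEAD seat p1 gen 12;
# the «odd → p·odd» step of the LEAD's prime-generic shift-equaliser conjecture, HOME/p1/CENSUS-shift-equaliser-p1-g11.md; `p = 3` is p3's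
# `…CubeStep.lean`, `p = 2` the seat's `…TwoShiftTransferStep.lean`)

Level `M` with `p ∤ M`, `p ≥ 5`; `K` a commutative ring with `p = 0`; `φ : Γ₀(pM) → K` additive with `φ(a, pb; c, d) = ε φ(a, b; pc, d)`
(`IsShiftEigenP p ε φ`, any `ε`).  The TRANSFER `V = Σₓ coshift φ ε (sec(g·x)⁻¹ g sec x)` of the coshift character from the index-`(p+1)`
subgroup `Stab(0)` (p3's abstract `CubeStep.transferSum`; section `[j:1] ↦ T^j`, `∞ ↦ s = (δ, −1; kM, p)`, `pδ + kM = 1`) is additive on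
`Γ₀(M)`, and `V = restr φ` on `kerAct` since `p + 1 ≡ 1`.  NEW for `p ≥ 5` (replacing the cocycle-of-`T` bookkeeping of the `p = 2, 3`
files): **every additive `f : Stab(∞) → K` vanishing on `kerAct` vanishes** (`eq_zero_on_stabInf`) — `Stab(∞)/kerAct` is the Borel
`B(𝔽_p)/±1`, whose abelianisation has order `(p−1)/2` prime to `p`; concretely, with `t ∈ Γ₀(pM)`, `t ≡ diag(2, ½)`, the identity
`tTt⁻¹ = y·T⁴`, `y ∈ kerAct`, gives `3·f(T) = 0`, so `f(T) = 0` (`3` is a unit as `p ≥ 5`); a diagonal-mod-`p` element `δ` has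
`δ^{p−1} ∈ kerAct` (Fermat), so `(p−1)·f(δ) = 0 = p·f(δ)`; and `Stab(∞) = (diagonal-mod-p)·⟨T⟩`.  Applied to `V − restr φ` and to
`y ↦ coshift(s⁻¹ys) − restr(y)` this gives `V = restr φ` on `Γ₀(pM)` and `V = coshift φ ε` on `Stab(0)`.
Main results: `eq_zero_on_stabInf`, **`transfer_descent`** (any `K` with `p = 0`, any `ε`, `p ≥ 5`, `p ∤ M`: every additive
`ε`-eigenfunction of the `p`-shift on `Γ₀(pM)` is the restriction of one on `Γ₀(M)`), the level laws **`shiftInvariantIsDiamondAtP_mul`**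
(`K_p(M) = D(M) ⟹ K_p(pM) = D(pM)`), `shiftEigenTrivialAtP_mul`; the bridge from p2's Serre base and the UNCONDITIONAL `K_p(pM) = D(pM)` are
in the sibling `…PShiftTransferBase.lean`.  Nothing about BSD, Manin's conjecture or C2/C3 is proved here.  References: MEMO-es §37.9; K. S. Brown,
*Cohomology of Groups*, III.9 [cite: DarmonDiamondTaylor1995, Lemma 4.28 (p. 135) (shape: degeneracy maps on `Γ₀`)].
-/

set_option autoImplicit false
set_option linter.dupNamespace false

open scoped MatrixGroups

open CongruenceSubgroup Matrix.SpecialLinearGroup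
  Summit.BirchSwinnertonDyer.Rank1Residual.ManinAdditive.NineShiftEqualiser

namespace Summit.BirchSwinnertonDyer.BirchSwinnertonDyer.Theorems.ManinLocalTwoThree

namespace PShiftTransfer

open ThreeShiftDescent TwoShift
open CubeStep (tr transferSum transferSum_mul transferSum_eq_card_smul Tpow_one_zpow_any)

/-! ### §1. The section of the orbit map at `0` and the transfer `V` -/

section TransferV

variable {p : ℕ} [Fact p.Prime] {K : Type*} [CommRing K] {M : ℕ}

/-- The action of `Γ₀(M)` on `P¹(𝔽_p)` through `SL(2, ℤ)`. [folklore] -/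
noncomputable def actG (γ : Gamma0 M) (ℓ : Option (ZMod p)) : Option (ZMod p) := act (γ : SL(2, ℤ)) ℓ

omit [CommRing K] in
/-- `actG` is an action. [folklore] -/
theorem actG_mul (g h : Gamma0 M) (x : Option (ZMod p)) : actG (g * h) x = actG g (actG h x) := act_mul _ _ _

omit [CommRing K] in
/-- `1` acts trivially. [folklore] -/
theorem actG_one (x : Option (ZMod p)) : actG (1 : Gamma0 M) x = x := act_one x

/-- The Bezout element `s = (δ, −1; kM, p)` (`pδ + kM = 1`), which maps `0 ↦ ∞`. [folklore] -/
def sElt (p M : ℕ) (δ k : ℤ) (hδ : (p : ℤ) * δ + k * M = 1) : Gamma0 M :=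
  g0Of δ (-1) (k * M) p (by linear_combination hδ) (dvd_mul_left _ _)

variable (δ k : ℤ) (hδ : (p : ℤ) * δ + k * M = 1)

omit [CommRing K] in
/-- `s·0 = ∞`. [folklore] -/
theorem act_sElt_zero : act (p := p) (sElt p M δ k hδ : SL(2, ℤ)) (some 0) = none := by
  rw [sElt, act_g0Of]
  simp [vec, label, Int.cast_natCast]

omit [CommRing K] in
/-- `s⁻¹·∞ = 0`. [folklore] -/
theorem act_sElt_inv_none : act (p := p) ((sElt p M δ k hδ)⁻¹ : SL(2, ℤ)) none = some 0 := by
  conv_lhs => rw [← act_sElt_zero δ k hδ]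
  rw [act_inv_act]

/-- The section of the orbit map `g ↦ g·0`: `[j:1] ↦ T^j`, `∞ ↦ s`. [folklore] -/
def sec (p M : ℕ) (δ k : ℤ) (hδ : (p : ℤ) * δ + k * M = 1) : Option (ZMod p) → Gamma0 M
  | none => sElt p M δ k hδ
  | some j => Tpow M ((j.val : ℕ) : ℤ)

omit [CommRing K] in
/-- `sec x · 0 = x`. [folklore] -/
theorem act_sec (x : Option (ZMod p)) : actG (sec p M δ k hδ x) (some 0) = x := by
  rcases x with _ | j
  · exact act_sElt_zero δ k hδ
  · show act _ _ = _
    rw [sec, act_Tpow_some, zero_add, intCast_val]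

variable (φ : Gamma0 (p * M) → K) (ε : K)

/-- **The transfer** of the coshift character from `stabZero = Stab(0)` to `Γ₀(M)`. [folklore] -/
noncomputable def V (g : Gamma0 M) : K := transferSum actG (sec p M δ k hδ) (coshift φ ε) g

/-- `V` is additive on `Γ₀(M)`. [folklore] -/
theorem V_mul (hadd : IsAdd φ) (g h : Gamma0 M) :
    V δ k hδ φ ε (g * h) = V δ k hδ φ ε g + V δ k hδ φ ε h :=
  transferSum_mul actG (sec p M δ k hδ) actG_mul actG_one (act_sec δ k hδ)
    (fun u v hu hv => coshift_add φ ε hadd u hu v hv) g h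

omit [Fact p.Prime] in
/-- `(p + 1) • r = r` when `p = 0` in `K`. [folklore] -/
theorem card_smul (hp : (p : K) = 0) (r : K) : (p + 1) • r = r := by
  rw [add_nsmul, one_nsmul, nsmul_eq_mul, hp, zero_mul, zero_add]

/-- **`V = restr φ` on `kerAct`.** [folklore] -/
theorem V_of_mem_kerAct (hp : (p : K) = 0) (hpM : ¬ p ∣ M) (hadd : IsAdd φ) (hinv : IsShiftEigenP p ε φ)
    {x : Gamma0 M} (hx : x ∈ kerAct p M) : V δ k hδ φ ε x = restr φ x := by
  have h : ∀ ℓ, coshift φ ε (tr actG (sec p M δ k hδ) x ℓ) = restr φ x := fun ℓ => by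
    have e : tr actG (sec p M δ k hδ) x ℓ = (sec p M δ k hδ ℓ)⁻¹ * x * sec p M δ k hδ ℓ := by
      unfold tr
      rw [show actG x ℓ = ℓ from hx ℓ]
    have hxc := kerAct_inv_conj_mem (sec p M δ k hδ ℓ) hx
    rw [e, coshift_eq_restr φ ε hpM hinv _ (stabZero_of_kerAct hxc) (stabInf_of_kerAct hxc)]
    simpa using restr_conj φ ε hpM hadd hinv (sec p M δ k hδ ℓ)⁻¹ hx
  unfold V
  rw [transferSum_eq_card_smul actG (sec p M δ k hδ) h, Fintype.card_option, ZMod.card, card_smul hp]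

end TransferV

/-! ### §2. For `p ≥ 5`: an additive function on `Stab(∞)` vanishing on `kerAct` vanishes -/

section MatrixPow

/-- Powers of a `2 × 2` matrix with zero off-diagonal entries: off-diagonal stays zero, diagonal entries are the powers. [folklore] -/
theorem pow_entries_of_offdiag_zero {R : Type*} [CommRing R] (X : Matrix (Fin 2) (Fin 2) R) (h01 : X 0 1 = 0)
    (h10 : X 1 0 = 0) (n : ℕ) :
    (X ^ n) 0 1 = 0 ∧ (X ^ n) 1 0 = 0 ∧ (X ^ n) 0 0 = X 0 0 ^ n ∧ (X ^ n) 1 1 = X 1 1 ^ n := by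
  induction n with
  | zero => simp
  | succ n ih =>
    obtain ⟨i01, i10, i00, i11⟩ := ih
    refine ⟨?_, ?_, ?_, ?_⟩ <;>
      simp [pow_succ, Matrix.mul_apply, Fin.sum_univ_two, i01, i10, i00, i11, h01, h10]

end MatrixPow

section Vanishing

variable {p : ℕ} [Fact p.Prime] {K : Type*} [CommRing K] {M : ℕ}

/-- A `Stab(0) ∩ Stab(∞)` element (diagonal mod `p`) has its `(p−1)`-st power in `kerAct` (Fermat). [folklore] -/
theorem pow_mem_kerAct {x : Gamma0 M} (hx0 : x ∈ stabZero p M) (hxi : x ∈ stabInf p M) : x ^ (p - 1) ∈ kerAct p M := by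
  have hb : ent (p := p) (x : SL(2, ℤ)) 0 1 = 0 := (ent_eq_zero_iff _ 0 1).mpr (mem_stabZero_iff.mp hx0)
  have hc : ent (p := p) (x : SL(2, ℤ)) 1 0 = 0 := (ent_eq_zero_iff _ 1 0).mpr ((act_none_eq_none_iff _).mp hxi)
  have hdet := det_ent (p := p) (x : SL(2, ℤ))
  rw [hb, zero_mul, sub_zero] at hdet
  have ha : ent (p := p) (x : SL(2, ℤ)) 0 0 ≠ 0 := fun h => by rw [h, zero_mul] at hdet; exact zero_ne_one hdet
  have hd : ent (p := p) (x : SL(2, ℤ)) 1 1 ≠ 0 := fun h => by rw [h, mul_zero] at hdet; exact zero_ne_one hdet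
  -- the mod-p reduction of `x` as a matrix and its powers
  set F := RingHom.mapMatrix (m := Fin 2) (Int.castRingHom (ZMod p)) with hF
  set X : Matrix (Fin 2) (Fin 2) (ZMod p) := F ((x : SL(2, ℤ)) : Matrix (Fin 2) (Fin 2) ℤ) with hX
  have hXe : ∀ i j : Fin 2, X i j = ent (p := p) (x : SL(2, ℤ)) i j := fun i j => by
    simp [hX, hF, ent]
  have hent : ∀ (n : ℕ) (i j : Fin 2), ent (p := p) ((x ^ n : Gamma0 M) : SL(2, ℤ)) i j = (X ^ n) i j := by
    intro n i j
    have h1 : X ^ n = F ((((x ^ n : Gamma0 M) : SL(2, ℤ)) : Matrix (Fin 2) (Fin 2) ℤ)) := by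
      rw [hX, ← map_pow, Subgroup.coe_pow, Matrix.SpecialLinearGroup.coe_pow]
    rw [h1]
    simp [hF, ent]
  obtain ⟨e01, e10, e00, e11⟩ :=
    pow_entries_of_offdiag_zero X (by rw [hXe]; exact hb) (by rw [hXe]; exact hc) (p - 1)
  have h00 : X 0 0 = ent (p := p) (x : SL(2, ℤ)) 0 0 := hXe 0 0
  have h11 : X 1 1 = ent (p := p) (x : SL(2, ℤ)) 1 1 := hXe 1 1
  refine mem_kerAct_of_entries ?_ ?_ ?_
  · rw [← ent_eq_zero_iff (p := p), hent, e01]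
  · rw [← ent_eq_zero_iff (p := p), hent, e10]
  · refine (ZMod.intCast_zmod_eq_zero_iff_dvd _ p).mp ?_
    push_cast
    change ent (p := p) ((x ^ (p - 1) : Gamma0 M) : SL(2, ℤ)) 0 0 - ent ((x ^ (p - 1) : Gamma0 M) : SL(2, ℤ)) 1 1 = 0
    rw [hent, hent, e00, e11, h00, h11, ZMod.pow_card_sub_one_eq_one ha, ZMod.pow_card_sub_one_eq_one hd, sub_self]

/-- **A test element**: for `p ∤ M` there is `t = (a b; c d) ∈ Γ₀(pM)` with `a ≡ 2 (mod p)` (`a = 1 + kM = 2 − pδ`). [folklore] -/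
theorem exists_test_elt (hpM : ¬ p ∣ M) (hp2 : p ≠ 2) :
    ∃ (a b c d : ℤ) (_ : a * d - b * c = 1), ((p * M : ℕ) : ℤ) ∣ c ∧ (p : ℤ) ∣ a - 2 := by
  have hp : p.Prime := Fact.out
  obtain ⟨δ, k, hδ⟩ := exists_bezout (p := p) hpM
  have hM' : IsCoprime (1 + k * M) (M : ℤ) := ⟨1, -k, by ring⟩
  have h2p : IsCoprime (2 : ℤ) (p : ℤ) := by
    have h : Nat.Coprime 2 p := (Nat.coprime_primes Nat.prime_two hp).mpr (Ne.symm hp2)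
    exact_mod_cast Nat.isCoprime_iff_coprime.mpr h
  have hap : IsCoprime (1 + k * M) (p : ℤ) := by
    have e : (1 + k * M : ℤ) = 2 + p * (-δ) := by linear_combination hδ
    rw [e]
    exact h2p.add_mul_left_left (-δ)
  obtain ⟨u, v, huv⟩ := hap.mul_right hM'
  refine ⟨1 + k * M, -v, p * M, u, by linear_combination huv, ⟨1, by push_cast; ring⟩, ⟨-δ, by linear_combination hδ⟩⟩

/-- `3` is a unit in `K` when `p = 0` in `K` and `p ≠ 3` is prime. [folklore] -/
theorem isUnit_three (hpK : (p : K) = 0) (hp3 : p ≠ 3) : IsUnit (3 : K) := by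
  have hp : p.Prime := Fact.out
  have h : Nat.Coprime 3 p := (Nat.coprime_primes Nat.prime_three hp).mpr (Ne.symm hp3)
  have h' : IsCoprime (3 : ℤ) (p : ℤ) := by exact_mod_cast Nat.isCoprime_iff_coprime.mpr h
  obtain ⟨u, v, huv⟩ := h'
  have e := congrArg (Int.cast : ℤ → K) huv
  push_cast at e
  rw [hpK, mul_zero, add_zero] at e
  exact isUnit_iff_exists_inv'.mpr ⟨(u : K), e⟩

variable {f : Gamma0 M → K}

/-- **Step 1: `f(T) = 0`.**  With the test element `t` (`a_t ≡ 2`), `w := tTt⁻¹ = (1 − ac, a²; −c², 1 + ac)` satisfies `w·t = t·T` and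
`w = y·T^{a²}` with `y ∈ kerAct`; so `f(T) = a²·f(T)`, `3 f(T) = 0`, `f(T) = 0` (`p ≥ 5`). [folklore] -/
theorem apply_Tpow_one_eq_zero (hpK : (p : K) = 0) (h5 : 5 ≤ p) (hpM : ¬ p ∣ M)
    (hf : ∀ x ∈ stabInf p M, ∀ y ∈ stabInf p M, f (x * y) = f x + f y) (hker : ∀ x ∈ kerAct p M, f x = 0) :
    f (Tpow M 1) = 0 := by
  obtain ⟨a, b, c, d, h, hc, ha2⟩ := exists_test_elt (p := p) hpM (by omega)
  have hcM : (M : ℤ) ∣ c := dvd_trans (by push_cast; exact dvd_mul_left _ _) hc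
  have hcp : (p : ℤ) ∣ c := dvd_trans (by push_cast; exact dvd_mul_right _ _) hc
  have hcc : ((p * M : ℕ) : ℤ) ∣ -(c * c) := (Dvd.dvd.mul_left hc c).neg_right
  have hccM : (M : ℤ) ∣ -(c * c) := (Dvd.dvd.mul_left hcM c).neg_right
  -- the players
  set t : Gamma0 M := g0Of a b c d h hcM with ht
  set w : Gamma0 M := g0Of (1 - a * c) (a * a) (-(c * c)) (1 + a * c) (by ring) hccM with hw
  set y : Gamma0 M := g0Of (1 - a * c) (a * a * a * c) (-(c * c)) (1 + a * c + a * a * c * c) (by ring) hccM with hy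
  have htB : t ∈ stabInf p M := g0Of_mem_stabInf hpM a b c d h hcM hc
  have hwB : w ∈ stabInf p M := g0Of_mem_stabInf hpM _ _ _ _ _ hccM hcc
  have hTB : ∀ j : ℤ, Tpow M j ∈ stabInf p M := fun j => Tpow_mem_stabInf j
  have hyK : y ∈ kerAct p M := by
    refine mem_kerAct_of_entries ?_ ?_ ?_
    · show (p : ℤ) ∣ a * a * a * c
      exact Dvd.dvd.mul_left hcp _
    · show (p : ℤ) ∣ -(c * c)
      exact (Dvd.dvd.mul_left hcp c).neg_right
    · show (p : ℤ) ∣ (1 - a * c) - (1 + a * c + a * a * c * c)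
      obtain ⟨m, hm⟩ := hcp
      exact ⟨-(2 * a * m + a * a * m * c), by rw [hm]; ring⟩
  -- `w t = t T`
  have h1 : w * t = t * Tpow M 1 := by
    rw [hw, ht, g0Of_mul _ _ _ _ _ _ _ _ _ _ _ _ (det_mul_entries (by ring) h)
      (dvd_add (Dvd.dvd.mul_right hccM _) (Dvd.dvd.mul_left hcM _)), g0Of_mul_Tpow a b c d h hcM 1
      (by linear_combination h)]
    exact g0Of_congr (by ring) (by linear_combination a * h) (by ring) (by linear_combination c * h) _ _ _ _
  -- `w = y T^{a²}`
  have h2 : w = y * Tpow M (a * a) := by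
    have : y = w * Tpow M (-(a * a)) := by
      rw [hy, hw, g0Of_mul_Tpow _ _ _ _ _ hccM (-(a * a)) (by ring)]
      exact g0Of_congr rfl (by ring) rfl (by ring) _ _ _ _
    rw [this, mul_assoc, Tpow_mul_Tpow, neg_add_cancel, Tpow_zero, mul_one]
  -- bookkeeping
  have e1 : f w + f t = f t + f (Tpow M 1) := by
    rw [← hf _ hwB _ htB, ← hf _ htB _ (hTB 1), h1]
  have e2 : f w = (a * a) • f (Tpow M 1) := by
    rw [h2, hf _ (stabInf_of_kerAct hyK) _ (hTB _), hker _ hyK, zero_add, ← Tpow_one_zpow_any,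
      addOn_map_zpow hf (hTB 1)]
  have e3 : (a * a - 1) • f (Tpow M 1) = 0 := by
    rw [sub_smul, one_smul, ← e2]
    linear_combination e1
  -- `a² − 1 = 3` in `K`
  obtain ⟨m, hm⟩ := ha2
  have e4 : ((a * a - 1 : ℤ) : K) = 3 := by
    have ea : a = 2 + p * m := by linear_combination hm
    rw [ea]
    push_cast
    rw [hpK]
    ring
  rw [zsmul_eq_mul, e4] at e3
  exact (isUnit_three hpK (by omega)).mul_right_eq_zero.mp e3

/-- **Step 2: `f` kills `Stab(0) ∩ Stab(∞)`** (`(p−1)·f(δ) = f(δ^{p−1}) = 0` and `p·f(δ) = 0`). [folklore] -/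
theorem apply_eq_zero_of_mem_stab (hpK : (p : K) = 0)
    (hf : ∀ x ∈ stabInf p M, ∀ y ∈ stabInf p M, f (x * y) = f x + f y) (hker : ∀ x ∈ kerAct p M, f x = 0)
    {x : Gamma0 M} (hx0 : x ∈ stabZero p M) (hxi : x ∈ stabInf p M) : f x = 0 := by
  have hp : p.Prime := Fact.out
  have h1 : ((p - 1 : ℕ) : ℤ) • f x = 0 := by
    rw [← addOn_map_zpow hf hxi, zpow_natCast]
    exact hker _ (pow_mem_kerAct hx0 hxi)
  have h2 : (p : ℕ) • f x = 0 := by rw [nsmul_eq_mul, hpK, zero_mul]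
  rw [natCast_zsmul] at h1
  have e : p = (p - 1) + 1 := (Nat.sub_add_cancel hp.one_le).symm
  rw [e, succ_nsmul, h1, zero_add] at h2
  exact h2

/-- **THE VANISHING LEMMA (`p ≥ 5`).**  An additive function on `Stab(∞) = Γ₀(pM)` (`p ∤ M`) with values in a ring where `p = 0`
that vanishes on `kerAct` vanishes identically — `Hom(B(𝔽_p)/±1, K) = 0`. [folklore] -/
theorem eq_zero_on_stabInf (hpK : (p : K) = 0) (h5 : 5 ≤ p) (hpM : ¬ p ∣ M)
    (hf : ∀ x ∈ stabInf p M, ∀ y ∈ stabInf p M, f (x * y) = f x + f y) (hker : ∀ x ∈ kerAct p M, f x = 0) :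
    ∀ y ∈ stabInf p M, f y = 0 := by
  intro y hy
  obtain ⟨j, c, hc0, hci, rfl⟩ := exists_stab_mul_Tpow hy
  rw [hf _ hci _ (Tpow_mem_stabInf j), apply_eq_zero_of_mem_stab hpK hf hker hc0 hci, ← Tpow_one_zpow_any,
    addOn_map_zpow hf (Tpow_mem_stabInf 1), apply_Tpow_one_eq_zero hpK h5 hpM hf hker, smul_zero, add_zero]

end Vanishing

/-! ### §3. `V = restr φ` on `Stab(∞)` and `V = coshift φ ε` on `Stab(0)` -/

section Values

variable {p : ℕ} [Fact p.Prime] {K : Type*} [CommRing K] {M : ℕ}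
  (δ k : ℤ) (hδ : (p : ℤ) * δ + k * M = 1) (φ : Gamma0 (p * M) → K) (ε : K)

/-- **`V = restr φ` on `stabInf = Γ₀(pM)`** (the vanishing lemma applied to `V − restr φ`). [folklore] -/
theorem V_of_mem_stabInf (hpK : (p : K) = 0) (h5 : 5 ≤ p) (hpM : ¬ p ∣ M) (hadd : IsAdd φ) (hinv : IsShiftEigenP p ε φ)
    {b : Gamma0 M} (hb : b ∈ stabInf p M) : V δ k hδ φ ε b = restr φ b := by
  have h : ∀ y ∈ stabInf p M, V δ k hδ φ ε y - restr φ y = 0 :=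
    eq_zero_on_stabInf (f := fun g => V δ k hδ φ ε g - restr φ g) hpK h5 hpM
      (fun x hx y hy => by
        show V δ k hδ φ ε (x * y) - restr φ (x * y) = (V δ k hδ φ ε x - restr φ x) + (V δ k hδ φ ε y - restr φ y)
        rw [V_mul δ k hδ φ ε hadd, restr_add φ hpM hadd x hx y hy]
        ring)
      (fun x hx => by
        show V δ k hδ φ ε x - restr φ x = 0
        rw [V_of_mem_kerAct δ k hδ φ ε hpK hpM hadd hinv hx, sub_self])
  exact sub_eq_zero.mp (h b hb)

/-- **`V = coshift φ ε` on `stabZero`** (the vanishing lemma applied to `y ↦ coshift(s⁻¹ys) − restr(y)`, then conjugate by `s`).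
[folklore] -/
theorem V_of_mem_stabZero (hpK : (p : K) = 0) (h5 : 5 ≤ p) (hpM : ¬ p ∣ M) (hadd : IsAdd φ) (hinv : IsShiftEigenP p ε φ)
    {a : Gamma0 M} (ha : a ∈ stabZero p M) : V δ k hδ φ ε a = coshift φ ε a := by
  set s := sElt p M δ k hδ with hs
  have hconj : ∀ y ∈ stabInf p M, s⁻¹ * y * s ∈ stabZero p M := fun y hy => by
    rw [mem_stabZero, Subgroup.coe_mul, Subgroup.coe_mul, act_mul, act_mul, act_sElt_zero δ k hδ,
      mem_stabInf.mp hy, Subgroup.coe_inv, act_sElt_inv_none δ k hδ]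
  -- the vanishing lemma for `g(y) = coshift(s⁻¹ y s) − restr(y)`
  have hg : ∀ y ∈ stabInf p M, coshift φ ε (s⁻¹ * y * s) - restr φ y = 0 :=
    eq_zero_on_stabInf (f := fun y => coshift φ ε (s⁻¹ * y * s) - restr φ y) hpK h5 hpM
      (fun x hx y hy => by
        show coshift φ ε (s⁻¹ * (x * y) * s) - restr φ (x * y) =
          (coshift φ ε (s⁻¹ * x * s) - restr φ x) + (coshift φ ε (s⁻¹ * y * s) - restr φ y)
        have e : s⁻¹ * (x * y) * s = (s⁻¹ * x * s) * (s⁻¹ * y * s) := by group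
        rw [e, coshift_add φ ε hadd _ (hconj x hx) _ (hconj y hy), restr_add φ hpM hadd x hx y hy]
        ring)
      (fun x hx => by
        show coshift φ ε (s⁻¹ * x * s) - restr φ x = 0
        have hxc := kerAct_inv_conj_mem s hx
        rw [coshift_eq_restr φ ε hpM hinv _ (stabZero_of_kerAct hxc) (stabInf_of_kerAct hxc)]
        have := restr_conj φ ε hpM hadd hinv s⁻¹ hx
        rw [inv_inv] at this
        rw [this, sub_self])
  -- apply it to `y = s a s⁻¹`
  have hb : s * a * s⁻¹ ∈ stabInf p M := by
    rw [mem_stabInf, Subgroup.coe_mul, Subgroup.coe_mul, act_mul, act_mul, Subgroup.coe_inv,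
      act_sElt_inv_none δ k hδ, mem_stabZero.mp ha, act_sElt_zero δ k hδ]
  have h1 := hg _ hb
  have e : s⁻¹ * (s * a * s⁻¹) * s = a := by group
  rw [e, sub_eq_zero] at h1
  -- and `V(s a s⁻¹) = V(a)`
  have hVconj : V δ k hδ φ ε (s * a * s⁻¹) = V δ k hδ φ ε a := by
    rw [V_mul δ k hδ φ ε hadd, V_mul δ k hδ φ ε hadd,
      addOn_map_inv (H := ⊤) (fun x _ y _ => V_mul δ k hδ φ ε hadd x y) (Subgroup.mem_top _)]
    abel
  rw [← hVconj, V_of_mem_stabInf δ k hδ φ ε hpK h5 hpM hadd hinv hb, ← h1]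

end Values

/-! ### §4. The transfer step `Γ₀(pM) → Γ₀(M)`, `p ∤ M`, `p ≥ 5` -/

section Main

variable {p : ℕ} [Fact p.Prime] {K : Type*} [CommRing K] {M : ℕ}

/-- **THE TRANSFER STEP for every prime `p ≥ 5`, any coefficients with `p = 0`, any eigenvalue.**  For `p ∤ M` and
`φ : Γ₀(pM) → K` additive with `φ(a, pb; c, d) = ε φ(a, b; pc, d)` (`pM ∣ c`), the transfer `w = V` is additive on `Γ₀(M)`, satisfies
`w(a, pb; c, d) = ε w(a, b; pc, d)` (`M ∣ c`), and restricts to `φ`. [new: transfer + the Borel vanishing lemma] -/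
theorem transfer_descent (hpK : (p : K) = 0) (h5 : 5 ≤ p) (hpM : ¬ p ∣ M) (φ : Gamma0 (p * M) → K) (ε : K)
    (hadd : IsAdd φ) (hinv : IsShiftEigenP p ε φ) :
    ∃ w : Gamma0 M → K, IsAdd w ∧ IsShiftEigenP p ε w ∧ RestrictsFrom φ w := by
  obtain ⟨δ, k, hδ⟩ := exists_bezout (p := p) hpM
  refine ⟨V δ k hδ φ ε, fun g h => V_mul δ k hδ φ ε hadd g h, ?_, ?_⟩
  · intro a b c d hdet hc
    rw [V_of_mem_stabZero δ k hδ φ ε hpK h5 hpM hadd hinv (g0Of_mem_stabZero a b c d (by linear_combination hdet) hc),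
      coshift_g0Of φ ε a b c d _ hc hdet (dvd_p_mul' hc),
      V_of_mem_stabInf δ k hδ φ ε hpK h5 hpM hadd hinv (g0Of_mem_stabInf hpM a b (p * c) d hdet _ (dvd_p_mul' hc)),
      restr_g0Of φ a b (p * c) d hdet _ (dvd_p_mul' hc)]
  · intro a b c d hdet hcN hcM
    rw [V_of_mem_stabInf δ k hδ φ ε hpK h5 hpM hadd hinv (g0Of_mem_stabInf hpM a b c d hdet hcM hcN),
      restr_g0Of φ a b c d hdet hcM hcN]

/-- **Level law: `K_p(M) = D(M) ⟹ K_p(pM) = D(pM)`** for `p ∤ M`, `p ≥ 5`, over any `K` with `p = 0`. [new] -/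
theorem shiftInvariantIsDiamondAtP_mul (hpK : (p : K) = 0) (h5 : 5 ≤ p) (hpM : ¬ p ∣ M)
    (hbase : ShiftInvariantIsDiamondAtP p M K) : ShiftInvariantIsDiamondAtP p (p * M) K := by
  intro φ hadd hinv
  obtain ⟨w, hw, hwinv, hres⟩ := transfer_descent hpK h5 hpM φ 1 hadd hinv
  exact isDiamond_of_restrictsFrom (dvd_mul_left M p) hres (hbase w hw hwinv)

/-- **Level law for eigenfunctions: `K^ε_p(M) = 0 ⟹ K^ε_p(pM) = 0`** for `p ∤ M`, `p ≥ 5`. [new] -/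
theorem shiftEigenTrivialAtP_mul (hpK : (p : K) = 0) (h5 : 5 ≤ p) (hpM : ¬ p ∣ M) (ε : K)
    (hbase : ShiftEigenTrivialAtP p M ε) : ShiftEigenTrivialAtP p (p * M) ε := by
  intro φ hadd hinv γ
  obtain ⟨w, hw, hwinv, hres⟩ := transfer_descent hpK h5 hpM φ ε hadd hinv
  exact TwoShift.eq_zero_of_restrictsFrom (dvd_mul_left M p) hres (hbase w hw hwinv) γ

end Main

end PShiftTransfer

end Summit.BirchSwinnertonDyer.BirchSwinnertonDyer.Theorems.ManinLocalTwoThree
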